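import Summits.QuantumAdvantage.QuantumAdvantage.Theses.RandomOracleGauge
import Summits.QuantumAdvantage.QuantumAdvantage.Theorems.RandomOracleGaugeOneBlockDecouplingStubSupBound
import Summits.QuantumAdvantage.QuantumAdvantage.Theorems.RandomOracleGaugeOneBlockDecouplingStubRealisation
import Summits.QuantumAdvantage.QuantumAdvantage.Theorems.RandomOracleGaugeOneBlockDecouplingStubComparison

/-!
# Route `RandomOracleGauge`, crux `OneBlockDecoupling` (stmt-QuantumAdvantage-17873) — PROVED

O'Donnell–Zhao ONE-BLOCK DECOUPLING as a reduction step for the Aaronson–Ambainis conjecture (arXiv:1512.01603,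
Cor. 2.12 + proof of Thm. 2.13): for every `[0,1]`-bounded `p` of total degree `≤ d` on `{0,1}^N` there is a
`[0,1]`-bounded ONE-BLOCK-DECOUPLED `q` on `Fin (N+N)` (`q(y,z) = c₀ + Σ_i (±1)^{y_i} g_i(z)`) of total degree
`≤ d` with `Var p ≤ K d^κ Var q` and every influence of `q` at most `K d^κ ×` some influence of `p`.

This file is the COMPOSITION of the registered line `Cruxes/AAConj/Lines/odonnell_zhao.lean` (its theorem
`OneBlockDecoupling_of`, re-proved here verbatim because a Theorems file cannot import a Cruxes file) applied to the
three stubs, all landed in the tree BY NAME: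

* `stub_supBound` (`…StubSupBound.lean`): `|dec p| ≤ 3d²` (Markov's inequality on the multilinear extension);
* `stub_realisation` (`…StubRealisation.lean`): `1/2 + dec p/(2C)` is the cube function of a bounded decoupled `q`
  of total degree `≤ d`;
* `stub_comparison` (`…StubComparison.lean`): `Var p ≤ 4C² Var q`, influences of `q ≤ (d/C²)·` influences of `p`.

With `C = 3d²`: `κ = 5`, `K = 4·3² + 3⁻² = 36 + 1/9`. **`OneBlockDecoupling_proof`** closes the crux BY NAME.
Consequence for the sibling route `SosSandwich`: its crux `PseudoBoundedAA` (stmt-QuantumAdvantage-15237) is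
implied by `AAConj` (`Theorems/RandomOracleGaugePromiseTransfer.lean`, `pseudoBoundedAA_of_aaConj`), and
`AAConj ⟸ DecoupledCoreAA ∧ OneBlockDecoupling ∧ VarianceAmplification` (`Theorems/RandomOracleGaugeAAConjAssembly.lean`);
after this file the open content of that reduction is `DecoupledCoreAA ∧ VarianceAmplification`.
No named facts beyond proved tree theorems; axioms standard.
-/

-- D-0017: single-conjunct summit ⇒ the duplicate `QuantumAdvantage.QuantumAdvantage` is mandated.
set_option linter.dupNamespace false

noncomputable section

open Literature.Computability.QuantumComplexity
open Summit.QuantumAdvantage.QuantumAdvantage.Cruxes.OneBlockDecoupling.OdonnellZhao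
  (stub_supBound stub_realisation stub_comparison)

namespace Summit.QuantumAdvantage.QuantumAdvantage.Theorems.RandomOracleGauge

/-- **The crux `OneBlockDecoupling` (stmt-QuantumAdvantage-17873), BY NAME** — O'Donnell–Zhao one-block
decoupling with polynomial losses, `(κ', K') = (2κ+1, 4K² + K⁻²) = (5, 36 + 1/9)` from the stub constants
`(κ, K) = (2, 3)`: the composition `OneBlockDecoupling_of` of the registered line `odonnell-zhao` applied to the
landed stubs `stub_supBound`, `stub_realisation`, `stub_comparison`. [cite: ODonnellZhao2016, Cor. 2.12 and Thm. 2.13] -/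
theorem OneBlockDecoupling_proof :
    Summit.QuantumAdvantage.QuantumAdvantage.Theses.RandomOracleGauge.OneBlockDecoupling := by
  obtain ⟨κ, K, hK, hS⟩ := stub_supBound
  refine ⟨2 * κ + 1, 4 * K ^ 2 + (K ^ 2)⁻¹, by positivity, ?_⟩
  intro N d p hd hdeg hb
  have hd1 : (1 : ℝ) ≤ d := by exact_mod_cast hd
  set C : ℝ := K * (d : ℝ) ^ κ with hCdef
  have hC : 0 < C := by positivity
  obtain ⟨q, hqdeg, hqf, hqb, hqdec⟩ := stub_realisation N d p C hC hdeg (hS N d p hd hdeg hb)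
  obtain ⟨hvar, hinf⟩ := stub_comparison N d p C q hd hdeg hC hqf
  refine ⟨q, hqdec, hqdeg, hqb, ?_, ?_⟩
  · -- Var p ≤ 4 C² Var q ≤ (4K² + K⁻²) d^{2κ+1} Var q
    have hVq : 0 ≤ boolVariance q := boolVariance_nonneg q
    have hC2 : 4 * C ^ 2 ≤ (4 * K ^ 2 + (K ^ 2)⁻¹) * (d : ℝ) ^ (2 * κ + 1) := by
      have h1 : 4 * C ^ 2 = 4 * K ^ 2 * (d : ℝ) ^ (2 * κ) := by
        rw [hCdef, mul_pow, ← pow_mul, mul_comm κ 2]; ring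
      rw [h1]
      have hdp : (d : ℝ) ^ (2 * κ) ≤ (d : ℝ) ^ (2 * κ + 1) := pow_le_pow_right₀ hd1 (Nat.le_succ _)
      have hKle : 4 * K ^ 2 ≤ 4 * K ^ 2 + (K ^ 2)⁻¹ := le_add_of_nonneg_right (by positivity)
      calc 4 * K ^ 2 * (d : ℝ) ^ (2 * κ) ≤ 4 * K ^ 2 * (d : ℝ) ^ (2 * κ + 1) :=
            mul_le_mul_of_nonneg_left hdp (by positivity)
        _ ≤ (4 * K ^ 2 + (K ^ 2)⁻¹) * (d : ℝ) ^ (2 * κ + 1) :=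
            mul_le_mul_of_nonneg_right hKle (by positivity)
    calc boolVariance p ≤ 4 * C ^ 2 * boolVariance q := hvar
      _ ≤ (4 * K ^ 2 + (K ^ 2)⁻¹) * (d : ℝ) ^ (2 * κ + 1) * boolVariance q :=
          mul_le_mul_of_nonneg_right hC2 hVq
  · intro j
    obtain ⟨i, hi⟩ := hinf j
    refine ⟨i, hi.trans ?_⟩
    have hIp : 0 ≤ influence i p := influence_nonneg i p
    apply mul_le_mul_of_nonneg_right _ hIp
    -- d / C² = d / (K² d^{2κ}) ≤ d / K² ≤ (4K² + K⁻²) d^{2κ+1}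
    have hden : K ^ 2 ≤ C ^ 2 := by
      rw [hCdef, mul_pow]
      have : (1 : ℝ) ≤ ((d : ℝ) ^ κ) ^ 2 := one_le_pow₀ (one_le_pow₀ hd1)
      nlinarith [sq_nonneg K]
    calc (d : ℝ) / C ^ 2 ≤ (d : ℝ) / K ^ 2 := div_le_div_of_nonneg_left (by positivity) (by positivity) hden
      _ = (K ^ 2)⁻¹ * (d : ℝ) ^ 1 := by rw [pow_one, div_eq_mul_inv, mul_comm]
      _ ≤ (4 * K ^ 2 + (K ^ 2)⁻¹) * (d : ℝ) ^ (2 * κ + 1) := by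
          apply mul_le_mul (le_add_of_nonneg_left (by positivity))
            (pow_le_pow_right₀ hd1 (by omega)) (by positivity) (by positivity)

end Summit.QuantumAdvantage.QuantumAdvantage.Theorems.RandomOracleGauge

end
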